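import Summits.BirchSwinnertonDyer.BirchSwinnertonDyer.Theorems.PrintCFramBottomClassIndexLawFiveLeSelmerDevissageCountRational
import Summits.BirchSwinnertonDyer.BirchSwinnertonDyer.Theorems.PrintCFramBottomClassIndexLawFiveLeLevelDictionaryRationalEngines
import Summits.BirchSwinnertonDyer.BirchSwinnertonDyer.Theorems.PrintCFramBottomClassIndexLawFiveLeLevelDictionaryPadic
import Summits.BirchSwinnertonDyer.BirchSwinnertonDyer.Theorems.PrintCFramBottomClassIndexLawFiveLeHerbrandRationalTransport
import HarnessLib

/-!
# Route `PrintCFram`, crux C2 `BottomClassIndexLawFiveLe` (stmt-BirchSwinnertonDyer-20372), line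
# `eisenstein-resource-bdp-line` (registry v19, stub B1 `stub_bsdp_of_classFactor`): **THE BRIDGE FROM THE RESIDUAL
# `H¹`-GROUPS TO CHARACTERS OF `Γ_K`** — counting form of T2 (`HerbrandLineRestriction`) + the transport
# `Γ_ℚ ⊇ N ↔ Γ_K` (`HerbrandRationalTransport`): `#H¹(Γ_ℚ, A; S) ≤ #V` for the group `V` of characters
# `κ : Γ_K →* 𝔽_p` with open kernel, unramified outside `S`, `θ`-isotypic
# (cell `bsd-print-cfram`, width seat `bsd-line-cfram-p1-w2` g9; helper `--supports` 20372; 0 defs, 0 facts, 0 sorry)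

HONEST FRAMING. Nothing about BSD is proved here and no stub is closed; pure group cohomology / Galois bookkeeping.
It connects the OUTPUT currency of the Selmer count (`…SelmerDevissageCountRational(Aligned)`: the groups
`R_rel(A) = h1Unramified A S_p`, `R_str(A) = R_rel(A) ⊓ ker res_{D_p}` of a discrete `Γ_ℚ`-module `A` of prime order `p`)
with the INPUT currency of the class-group counts of w7 g3 (`HerbrandKummer.finite_and_natCard_le_classGroupChiCard_of_characters`,
`HerbrandOddClassGroup.finite_and_natCard_le_classGroupChiCard_of_unramified_characters`: subgroups `V` of characters
`κ : Γ_K →* Multiplicative (ZMod p)` with open kernel, killing the inertia groups `I_𝔔` (`𝔔 ∣ u`, `u ∉ S`), and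
`κ (γ σ γ⁻¹) = κ σ ^ θ(γ)`), for a number field `K` Galois over `ℚ` on which the character `θ` of `A` is trivial.

* §1 `coboundaryOn_conj` — a crossed homomorphism principal on a subgroup `I` is principal on `g I g⁻¹`
  (`z h = h • b − b`, `b = g a − z g`); `mem_unramifiedKer_of_mem_subgroupResKer_decomp` — principal on the decomposition
  group `D_v` ⟹ principal on the inertia group of EVERY prime above `v` (all conjugate to the distinguished one, tree
  `exists_smul_eq_of_mem_primesAbove_holds`, `Ideal.conj_mem_inertia_smul_iff`); **`inf_subgroupResKer_decomp_le_h1Unramified`**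
  — `h1Unramified A S ⊓ ker res_{D_v} ≤ h1Unramified A (S \ {v})`, and over `ℚ` with `S = S_p`:
  **`R_str(A) ≤ h1Unramified A ∅`** (`inf_subgroupResKer_decomp_le_h1Unramified_empty`; the place above `p` is unique).
* §2 **`exists_characters_natCard_h1Unramified_le`** — `A` of order `p` with continuous orbit maps, acted on non-trivially
  through `θ : Γ_ℚ →* 𝔽_pˣ`; `K/ℚ` finite Galois with `θ(res Γ_K) = 1` and `(ker θ)^k ⊆ res Γ_K` for some `p ∤ k`; `S` any
  set of places of `ℚ`. THEN there is a subgroup `V` of `Γ_K →* Multiplicative (ZMod p)` all of whose members have open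
  kernel, kill `I_𝔔` for every prime `𝔔` of `\bar ℤ_K` above a place `u` with `u ∩ ℚ ∉ S`, and satisfy
  `κ (absGaloisOuterConj ℚ K γ σ) = κ σ ^ (θ γ).val`, such that **`Finite V → #h1Unramified A S ≤ #V`**. The map is
  `[z] ↦ (σ ↦ e (z (res σ)))` (`e : A ≃ ℤ/p`); it is injective because a cocycle vanishing on `res Γ_K` vanishes on
  `N = ker θ` (`z(n^k) = k z(n)`, `p ∤ k`) and restriction `H¹(Γ_ℚ, A) → H¹(N, A)` is injective (T2,
  `HerbrandLineRestriction.subgroupResKer_ker_eq_bot_of_card_prime`).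
  With w7 g3's counts this gives `#R_rel(A) ≤ classGroupChiCard …` (EVEN side, `S = S_p`) and, through §1,
  `#R_str(A) ≤ #h1Unramified A ∅ ≤ classGroupChiCard …` (ODD side, `S = ∅`).

THEOREMS ONLY; no definition, no named fact, no `sorry`. BSD is not proved by any of this; no summit statement is
proved by this seat. References: [SerreGaloisCohomology1997] I.§2.6 (b), I.§5.1; [NeukirchANT1999] Ch. I §9 (9.4)–(9.6),
Ch. IV §1; [GreenbergLNM1716] §3 (PDF p. 86); the LEAD g10 report §2 and seat notes w2g8 §4.
-/

set_option autoImplicit false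
-- `…BirchSwinnertonDyer.BirchSwinnertonDyer.Theorems…` is the problem's mandated namespace (D-0017).
set_option linter.dupNamespace false

noncomputable section

open scoped Classical Pointwise

namespace Summit.BirchSwinnertonDyer.BirchSwinnertonDyer.Theorems.PrintCFram.SelmerCount

open NumberField IsDedekindDomain Field
open Literature.NumberTheory.EllipticCurves Literature.NumberTheory.GaloisRepresentations
  Literature.NumberTheory.EllipticCurves.GreenbergSelmer
open Summit.BirchSwinnertonDyer.BirchSwinnertonDyer.Theorems.PrintCFram.LevelDictionary
open Summit.BirchSwinnertonDyer.BirchSwinnertonDyer.Theorems.PrintCFram.HerbrandSelmerToHom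
open Summit.BirchSwinnertonDyer.BirchSwinnertonDyer.Theorems.PrintCFram.LevelDictionaryAlpha

/-! ## §1 Principal on `D_v` ⟹ principal on every inertia group above `v` -/

section Conj

variable {G : Type} [Group G] [TopologicalSpace G]
variable {M : Type} [AddCommGroup M] [DistribMulAction G M] [TopologicalSpace M] [DiscreteTopology M]

/-- **Principal on `I` ⟹ principal on `g I g⁻¹`.** If `z i = i • a − a` for `i ∈ I`, then for every `h` with
`g⁻¹ h g ∈ I`: `z h = h • b − b` with `b = g • a − z g` (the cocycle identities `z(xy) = z x + x • z y`, `g • z(g⁻¹) = −z g`).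
[cite: SerreGaloisCohomology1997, I.§5.1] -/
theorem coboundaryOn_conj (z : contOneCocycles (discreteTopRep G M)) {I : Subgroup G} {a : M}
    (hz : ∀ i ∈ I, z.1 i = i • a - a) (g : G) {h : G} (hh : g⁻¹ * h * g ∈ I) :
    z.1 h = h • (g • a - z.1 g) - (g • a - z.1 g) := by
  have hdecomp : h = g * (g⁻¹ * h * g) * g⁻¹ := by group
  have h1 : z.1 h = z.1 g + g • z.1 (g⁻¹ * h * g) + (g * (g⁻¹ * h * g)) • z.1 g⁻¹ := by
    conv_lhs => rw [hdecomp]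
    rw [cocycle_mul' z (g * (g⁻¹ * h * g)) g⁻¹, cocycle_mul' z g (g⁻¹ * h * g)]
  have h2 : (g * (g⁻¹ * h * g)) • z.1 g⁻¹ = -(h • z.1 g) := by
    rw [cocycle_inv' z g, smul_neg, smul_smul]
    congr 2
    group
  rw [h1, h2, hz _ hh, smul_sub, smul_smul, smul_sub]
  have h3 : (g * (g⁻¹ * h * g)) • a = (h * g) • a := by congr 1; group
  rw [h3, mul_smul]
  abel

end Conj

section Decomp

variable {K : Type} [Field K] [NumberField K]
variable (A : Type) [AddCommGroup A] [DistribMulAction (absoluteGaloisGroup K) A] [TopologicalSpace A]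
  [DiscreteTopology A]

/-- **Principal on `D_v` ⟹ unramified at every prime above `v`.** A class of `H¹(K, A)` restricting to zero on the
decomposition group `D_v = decomp v` restricts to zero on the inertia group `I_𝔓` of EVERY prime `𝔓` of `\bar ℤ_K` above
`v`: the distinguished prime `𝔓₀ = adicCompletionPrime K v` has `I_𝔓₀ ≤ D_v`, every `𝔓 ∣ v` is `g • 𝔓₀`
(`exists_smul_eq_of_mem_primesAbove_holds`), and `I_{g • 𝔓₀} = g I_𝔓₀ g⁻¹` (`Ideal.conj_mem_inertia_smul_iff`, §1).
[cite: NeukirchANT1999, Ch. I §9 (9.4)–(9.6)] -/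
theorem mem_unramifiedKer_of_mem_subgroupResKer_decomp (v : HeightOneSpectrum (𝓞 K))
    {c : discreteH1 (absoluteGaloisGroup K) A} (hc : c ∈ subgroupResKer A (decomp v))
    {𝔓 : Ideal (absIntegers (𝓞 K) K)} (h𝔓 : 𝔓 ∈ v.primesAbove) : c ∈ unramifiedKer A 𝔓 := by
  obtain ⟨z, rfl⟩ := oneCocycleClass_surjective _ c
  obtain ⟨a, ha⟩ := (oneCocycleClass_mem_subgroupResKer_iff _ z).1 hc
  obtain ⟨g, hg⟩ := HeightOneSpectrum.exists_smul_eq_of_mem_primesAbove_holds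
    (adicCompletionPrime_mem_primesAbove K v) h𝔓
  refine (oneCocycleClass_mem_subgroupResKer_iff _ z).2 ⟨g • a - z.1 g, fun τ ↦ ?_⟩
  refine coboundaryOn_conj z (I := decomp v) (fun i hi ↦ ha ⟨i, hi⟩) g ?_
  -- `g⁻¹ τ g ∈ I_𝔓₀ ≤ D_v`
  have hτ : (τ : absoluteGaloisGroup K) ∈ (g • adicCompletionPrime K v).inertia (absoluteGaloisGroup K) := by
    rw [hg]; exact τ.2
  have hconj : g⁻¹ * (τ : absoluteGaloisGroup K) * g ∈
      (adicCompletionPrime K v).inertia (absoluteGaloisGroup K) := by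
    rw [← Ideal.conj_mem_inertia_smul_iff (adicCompletionPrime K v) g]
    simpa [mul_assoc] using hτ
  rw [inertia_adicCompletionPrime_eq_map_absInertia] at hconj
  exact inertia_le_decomp v hconj

/-- **`h1Unramified A S ⊓ ker res_{D_v} ≤ h1Unramified A (S \ {v})`**: a class unramified outside `S` and trivial on
`D_v` is unramified outside `S \ {v}`. [cite: SilvermanAEC2009, Lemma X.4.3] -/
theorem inf_subgroupResKer_decomp_le_h1Unramified (S : Set (HeightOneSpectrum (𝓞 K)))
    (v : HeightOneSpectrum (𝓞 K)) :
    h1Unramified A S ⊓ subgroupResKer A (decomp v) ≤ h1Unramified A (S \ {v}) := by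
  intro c hc
  obtain ⟨hS, hD⟩ := AddSubgroup.mem_inf.mp hc
  refine mem_h1Unramified_iff.2 fun v' hv' 𝔓 h𝔓 ↦ ?_
  by_cases hvv : v' = v
  · subst hvv
    exact mem_unramifiedKer_of_mem_subgroupResKer_decomp A v' hD h𝔓
  · exact mem_h1Unramified_iff.1 hS v' (fun h ↦ hv' ⟨h, hvv⟩) 𝔓 h𝔓

end Decomp

/-- **Over `ℚ`: `R_str(A) ≤ h1Unramified A ∅`** — a class unramified away from `p` and trivial on `D_p` is unramified
EVERYWHERE (the place of `ℚ` above `p` is unique). [cite: SilvermanAEC2009, Lemma X.4.3] -/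
theorem inf_subgroupResKer_decomp_le_h1Unramified_empty {p : ℕ} [hp : Fact p.Prime]
    (A : Type) [AddCommGroup A] [DistribMulAction (absoluteGaloisGroup ℚ) A] [TopologicalSpace A] [DiscreteTopology A]
    {v : HeightOneSpectrum (𝓞 ℚ)} (hpv : ((p : ℕ) : 𝓞 ℚ) ∈ v.asIdeal) :
    h1Unramified A {v' : HeightOneSpectrum (𝓞 ℚ) | ((p : ℕ) : 𝓞 ℚ) ∈ v'.asIdeal} ⊓ subgroupResKer A (decomp v) ≤
      h1Unramified A (∅ : Set (HeightOneSpectrum (𝓞 ℚ))) := by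
  refine (inf_subgroupResKer_decomp_le_h1Unramified A _ v).trans (h1Unramified_mono A fun v' hv' ↦ ?_)
  obtain ⟨hv', hne⟩ := hv'
  exact hne (Rat.HeightOneSpectrum.primesEquiv.injective (Subtype.ext
    ((LevelDictionary.primesEquiv_eq_of_natCast_mem v' hp.out hv').trans
      (LevelDictionary.primesEquiv_eq_of_natCast_mem v hp.out hpv).symm)))

/-! ## §2 The bridge: `#H¹(Γ_ℚ, A; S) ≤ #V` -/

section Bridge

variable {p : ℕ} [hp : Fact p.Prime]
variable {A : Type} [AddCommGroup A] [DistribMulAction (absoluteGaloisGroup ℚ) A] [TopologicalSpace A]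
  [DiscreteTopology A]
variable {K : Type} [Field K] [NumberField K] [IsGalois ℚ K]

/-- **THE BRIDGE.** `A` a discrete `Γ_ℚ`-module of prime order `p` with continuous orbit maps, acted on non-trivially
through `θ : Γ_ℚ →* 𝔽_pˣ` (`g • a = θ(g) • a`, `θ g = 1 ↔ g` acts trivially); `K/ℚ` finite Galois with `θ` trivial on
`res Γ_K` and `(ker θ)^k ⊆ res Γ_K` for some `k` prime to `p` (e.g. `K = ℚ̄^{ker θ}` with `k = 1`, or the CM field
`ℚ̄^{ker θ ∩ ker χ̄_p}` of `LevelDictionaryAlpha.exists_cmField_of_character`); `S` a set of finite places of `ℚ`. Then there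
is a subgroup `V` of `Γ_K →* Multiplicative (ZMod p)` whose members have OPEN kernel, kill the inertia group of every prime
of `\bar ℤ_K` above a place `u` with `u ∩ ℚ ∉ S`, and are `θ`-isotypic under outer conjugation by `Γ_ℚ`, such that
`Finite V → #H¹(Γ_ℚ, A; S) ≤ #V`. (`V` = all such characters; the injection is `[z] ↦ (σ ↦ e (z (res σ)))`, well defined
and injective by T2 and the `n ↦ n^k` lift.) [cite: SerreGaloisCohomology1997, I.§2.6 (b) and I.§5.1]
[cite: NeukirchANT1999, Ch. I §9 (9.4)–(9.6); Ch. IV §1] [cite: GreenbergLNM1716, §3 (PDF p. 86)] -/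
theorem exists_characters_natCard_h1Unramified_le (hcard : Nat.card A = p)
    (hcont : ∀ a : A, Continuous fun g : absoluteGaloisGroup ℚ ↦ g • a)
    (hnt : ∃ (g : absoluteGaloisGroup ℚ) (a : A), g • a ≠ a)
    (θ : absoluteGaloisGroup ℚ →* (ZMod p)ˣ)
    (hθ : ∀ (g : absoluteGaloisGroup ℚ) (a : A), g • a = (((θ g : ZMod p).val : ℕ) : ℤ) • a)
    (hker : ∀ g : absoluteGaloisGroup ℚ, θ g = 1 ↔ ∀ a : A, g • a = a)
    (hrK : ∀ σ : absoluteGaloisGroup K, θ (absGaloisRestrict ℚ K σ) = 1)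
    (hpow : ∃ k : ℕ, ¬ p ∣ k ∧ ∀ n : absoluteGaloisGroup ℚ, θ n = 1 → n ^ k ∈ (absGaloisRestrict ℚ K).range)
    (S : Set (HeightOneSpectrum (𝓞 ℚ))) :
    ∃ V : Subgroup (absoluteGaloisGroup K →* Multiplicative (ZMod p)),
      (∀ κ ∈ V, IsOpen (κ.ker : Set (absoluteGaloisGroup K))) ∧
      (∀ κ ∈ V, ∀ u : HeightOneSpectrum (𝓞 K), u.under (𝓞 ℚ) ∉ S →
        ∀ 𝔔 ∈ u.primesAbove, ∀ g ∈ 𝔔.inertia (absoluteGaloisGroup K), κ g = 1) ∧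
      (∀ κ ∈ V, ∀ (γ : absoluteGaloisGroup ℚ) (σ : absoluteGaloisGroup K),
        κ (absGaloisOuterConj ℚ K γ σ) = κ σ ^ ((θ γ : (ZMod p)ˣ) : ZMod p).val) ∧
      (Finite V → Nat.card ↥(h1Unramified A S) ≤ Nat.card V) := by
  haveI : NeZero p := ⟨hp.out.ne_zero⟩
  -- the subgroup of all admissible characters
  let V : Subgroup (absoluteGaloisGroup K →* Multiplicative (ZMod p)) :=
    { carrier := {κ | IsOpen (κ.ker : Set (absoluteGaloisGroup K)) ∧
        (∀ u : HeightOneSpectrum (𝓞 K), u.under (𝓞 ℚ) ∉ S →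
          ∀ 𝔔 ∈ u.primesAbove, ∀ g ∈ 𝔔.inertia (absoluteGaloisGroup K), κ g = 1) ∧
        ∀ (γ : absoluteGaloisGroup ℚ) (σ : absoluteGaloisGroup K),
          κ (absGaloisOuterConj ℚ K γ σ) = κ σ ^ ((θ γ : (ZMod p)ˣ) : ZMod p).val}
      one_mem' := by
        refine ⟨?_, fun u _ 𝔔 _ g _ ↦ rfl, fun γ σ ↦ by rw [MonoidHom.one_apply, MonoidHom.one_apply, one_pow]⟩
        have : ((1 : absoluteGaloisGroup K →* Multiplicative (ZMod p)).ker : Set (absoluteGaloisGroup K)) =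
            Set.univ := by
          ext g; simp
        rw [this]; exact isOpen_univ
      mul_mem' := by
        rintro κ₁ κ₂ ⟨hk₁, hu₁, he₁⟩ ⟨hk₂, hu₂, he₂⟩
        refine ⟨?_, fun u hu 𝔔 h𝔔 g hg ↦ ?_, fun γ σ ↦ ?_⟩
        · apply Subgroup.isOpen_mono (H₁ := κ₁.ker ⊓ κ₂.ker)
          · intro g hg
            obtain ⟨h1, h2⟩ := Subgroup.mem_inf.mp hg
            rw [MonoidHom.mem_ker] at h1 h2 ⊢
            rw [MonoidHom.mul_apply, h1, h2, mul_one]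
          · rw [Subgroup.coe_inf]; exact hk₁.inter hk₂
        · rw [MonoidHom.mul_apply, hu₁ u hu 𝔔 h𝔔 g hg, hu₂ u hu 𝔔 h𝔔 g hg, mul_one]
        · rw [MonoidHom.mul_apply, MonoidHom.mul_apply, he₁, he₂, mul_pow]
      inv_mem' := by
        rintro κ ⟨hk, hu, he⟩
        refine ⟨?_, fun u hu' 𝔔 h𝔔 g hg ↦ ?_, fun γ σ ↦ ?_⟩
        · have : ((κ⁻¹).ker : Set (absoluteGaloisGroup K)) = κ.ker := by
            ext g; simp [MonoidHom.mem_ker]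
          rw [this]; exact hk
        · rw [MonoidHom.inv_apply, hu u hu' 𝔔 h𝔔 g hg, inv_one]
        · rw [MonoidHom.inv_apply, MonoidHom.inv_apply, he, inv_pow] }
  refine ⟨V, fun κ hκ ↦ hκ.1, fun κ hκ ↦ hκ.2.1, fun κ hκ ↦ hκ.2.2, fun hfin ↦ ?_⟩
  haveI := hfin
  -- bookkeeping: `res Γ_K` acts trivially, `N = ker θ`
  have htriv : ∀ (σ : absoluteGaloisGroup K) (a : A), absGaloisRestrict ℚ K σ • a = a :=
    fun σ ↦ (hker _).1 (hrK σ)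
  have hNθ : ∀ g : absoluteGaloisGroup ℚ, g ∈ (MulAction.toPermHom (absoluteGaloisGroup ℚ) A).ker ↔ θ g = 1 :=
    fun g ↦ by rw [← ker_eq_ker_toPermHom θ hker, MonoidHom.mem_ker]
  haveI : IsAddCyclic A := isAddCyclic_of_prime_card hcard
  let e : A ≃+ ZMod p := addEquivOfAddCyclicCardEq (by rw [hcard, Nat.card_zmod])
  -- the character of a cocycle
  have hadd : ∀ (z : contOneCocycles (discreteTopRep (absoluteGaloisGroup ℚ) A)) (σ τ : absoluteGaloisGroup K),
      z.1 (absGaloisRestrict ℚ K (σ * τ)) = z.1 (absGaloisRestrict ℚ K σ) + z.1 (absGaloisRestrict ℚ K τ) :=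
    fun z σ τ ↦ by rw [map_mul]; exact cocycle_apply_mul_of_forall_smul_eq z (htriv σ) _
  let χ : contOneCocycles (discreteTopRep (absoluteGaloisGroup ℚ) A) →
      (absoluteGaloisGroup K →* Multiplicative (ZMod p)) := fun z ↦
    { toFun := fun σ ↦ Multiplicative.ofAdd (e (z.1 (absGaloisRestrict ℚ K σ)))
      map_one' := by rw [map_one, contOneCocycles.apply_one, map_zero, ofAdd_zero]
      map_mul' := fun σ τ ↦ by rw [hadd, map_add, ofAdd_add] }
  have hχ : ∀ z σ, χ z σ = Multiplicative.ofAdd (e (z.1 (absGaloisRestrict ℚ K σ))) := fun _ _ ↦ rfl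
  -- the characters of unramified classes are admissible
  have hmemV : ∀ z : contOneCocycles (discreteTopRep (absoluteGaloisGroup ℚ) A),
      oneCocycleClass _ z ∈ h1Unramified A S → χ z ∈ V := by
    intro z hz
    refine ⟨?_, fun u hu 𝔔 h𝔔 g hg ↦ ?_, fun γ σ ↦ ?_⟩
    · refine isOpen_ker_of_continuous (fun σ ↦ e (z.1 (absGaloisRestrict ℚ K σ))) ?_ (χ z) (hχ z)
      exact continuous_of_discreteTopology.comp (z.1.continuous.comp (absGaloisRestrict ℚ K).continuous)
    · -- unramified at the prime below `𝔔`
      have hmem := mem_h1Unramified_iff.1 hz (u.under (𝓞 ℚ)) hu (𝔔.comap (absIntegersMap ℚ K))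
        (comap_absIntegersMap_mem_primesAbove (K := ℚ) (M := K) (v := u.under (𝓞 ℚ)) (w := u) rfl h𝔔)
      obtain ⟨a, ha⟩ := (oneCocycleClass_mem_subgroupResKer_iff _ z).1 hmem
      have hgI := (mem_inertia_iff_absGaloisRestrict_mem (K := ℚ) 𝔔 g).mp hg
      rw [hχ, apply_eq_zero_of_coboundaryOn_of_forall_smul_eq z (fun i hi ↦ ha ⟨i, hi⟩) hgI (htriv g),
        map_zero, ofAdd_zero]
    · rw [hχ, hχ, Literature.NumberTheory.GaloisRepresentations.absGaloisRestrict_absGaloisOuterConj ℚ K,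
        addEquiv_conj_eq_mul θ hθ e z.1 (cocycle_apply_conj_of_forall_smul_eq z γ (htriv σ)),
        ofAdd_mul_eq_pow_val]
  -- the map on classes and its injectivity
  choose zc hzc using fun c : ↥(h1Unramified A S) ↦ oneCocycleClass_surjective (discreteTopRep _ A) c.1
  let Ψ : ↥(h1Unramified A S) → V := fun c ↦ ⟨χ (zc c), hmemV (zc c) (by rw [hzc]; exact c.2)⟩
  refine Nat.card_le_card_of_injective Ψ fun c c' hcc' ↦ ?_
  have hval : ∀ σ : absoluteGaloisGroup K,
      (zc c - zc c').1 (absGaloisRestrict ℚ K σ) = 0 := fun σ ↦ by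
    have h := congrArg (fun κ : V ↦ (κ : absoluteGaloisGroup K →* Multiplicative (ZMod p)) σ) hcc'
    simp only [Ψ, hχ, Multiplicative.ofAdd.apply_eq_iff_eq, EmbeddingLike.apply_eq_iff_eq] at h
    change (zc c).1 _ - (zc c').1 _ = 0
    rw [h, sub_self]
  -- vanishing on `res Γ_K` lifts to `N = ker θ` through `n ↦ n^k`
  obtain ⟨k, hk, hpowk⟩ := hpow
  set d := zc c - zc c' with hd
  have hdN : ∀ n : (MulAction.toPermHom (absoluteGaloisGroup ℚ) A).ker, d.1 n = 0 := by
    rintro ⟨n, hn⟩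
    obtain ⟨σ, hσ⟩ := hpowk n ((hNθ n).1 hn)
    have hσ' : absGaloisRestrict ℚ K σ = n ^ k := hσ
    have h0 : e (d.1 (n ^ k)) = 0 := by rw [← hσ', hval σ, map_zero]
    have haddN : ∀ a ∈ (MulAction.toPermHom (absoluteGaloisGroup ℚ) A).ker,
        ∀ b ∈ (MulAction.toPermHom (absoluteGaloisGroup ℚ) A).ker, d.1 (a * b) = d.1 a + d.1 b :=
      fun a ha b _ ↦ cocycle_apply_mul_of_forall_smul_eq d ((mem_ker_toPermHom_iff' a).1 ha) b
    rw [addEquiv_apply_pow e d.1 _ haddN hn k] at h0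
    have hkne : (k : ZMod p) ≠ 0 := by rw [Ne, ZMod.natCast_eq_zero_iff]; exact hk
    exact e.map_eq_zero_iff.1 ((mul_eq_zero.1 h0).resolve_left hkne)
  have hd0 : oneCocycleClass _ d = 0 :=
    oneCocycleClass_eq_zero_of_forall_apply_eq_zero _
      (HerbrandLineRestriction.subgroupResKer_ker_eq_bot_of_card_prime hcard hcont hnt) d hdN
  apply Subtype.ext
  rw [← hzc c, ← hzc c', ← sub_eq_zero, ← oneCocycleClass_sub, ← hd]
  exact hd0

end Bridge

end Summit.BirchSwinnertonDyer.BirchSwinnertonDyer.Theorems.PrintCFram.SelmerCount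

end
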